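import Summits.NavierStokesRegularity.NavierStokesRegularity.Theses.PlaneEnergyCeiling
import Summits.NavierStokesRegularity.NavierStokesRegularity.Theorems.BoundedPlanarEnergyRegularity.Negative.LerayHopfClauseLoadBearing
import Literature.Analysis.FluidPDE.BlowupAncientSolutionProofs

/-!
# `PlanarEnergyZoomA` (stmt-NavierStokesRegularity-16915): logical structure and the load-bearing planar clause

Negative (support) lemmas for the crux `PlaneEnergyCeiling.PlanarEnergyZoomA` (route `PlaneEnergyCeiling`,
rank 5, hypothesis `h₅` of the route's `closes`), extracted from the crux-attack work file
`Cruxes/PlanarEnergyZoomA/Disproof.lean` (refuter crux-attack seat, 2026-08-17). No positive route item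
is asserted here.

The crux reads `∀ ν > 0, ∀ Clay datum u₀, PlanarHyp ν u₀ → ¬ ClayA ν u₀ → W`, where `PlanarHyp ν u₀` is
the planar-energy bound along every classical Leray–Hopf solution from `u₀`, `ClayA ν u₀` is the summit's
conclusion at `u₀`, and the conclusion `W` ("there is a NONZERO bounded ancient duality-mild solution,
`ν = 1`, measurable slices, jointly smooth on `(-∞,0) × ℝ³`, with planar energies bounded uniformly in
`t, R, c`") is a CLOSED proposition — it mentions neither `ν` nor `u₀` — and is literally the negation of
the partner crux `PlanarEnergyLiouville`.

* `planarEnergyZoomA_iff_liouville_imp_regularity` — PURE LOGIC: the crux is EQUIVALENT to the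
  implication between its two partner cruxes, `PlanarEnergyLiouville → BoundedPlanarEnergyRegularity`;
  `not_planarEnergyZoomA_iff` — so a refutation must produce the Liouville THEOREM in the planar class
  together with a Clay counterexample with bounded planar energies (neither is available: no cheap kill),
  and under `PlanarEnergyLiouville` the crux and the criterion crux are interchangeable.
* `zoomA_without_notClayA_iff_not_liouville` — dropping the hypothesis `¬ ClayA` (everything else
  verbatim) turns the crux into `¬ PlanarEnergyLiouville` EXACTLY (instantiate at the zero datum, where
  the planar hypothesis holds by `planar_bound_of_zero_datum`); `zoomA_false_without_notClayA_of_liouville`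
  — hence that variant is FALSE under the partner crux: `¬ ClayA` is load-bearing modulo Liouville.
* `zoomA_without_planarHyp_iff` — dropping the planar hypothesis turns the crux into
  `PlanarEnergyLiouville → NavierStokesRegularity` EXACTLY (strictly stronger; still summit-implied).
* `zoomA_conclusion_without_planar_bound` — dropping the planar clause from the CONCLUSION makes it
  trivially inhabited by the constant field `e₀` (in-tree `isBoundedAncientMildSolution_fun_const`:
  constants — and the parasitic drifts `b(t)` — belong to the tree's duality-form bounded ancient class);
  `lintegral_plane_const_eq_top` — a nonzero constant has planar energy `⊤` through every plane, so the
  planar clause is exactly the filter removing them; `exists_isKNSSBlowupLimit_planar_unbounded` — in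
  particular the in-tree KNSS Prop. 6.1 (`KNSS2009_blowup_generates_ancient_holds`, whose conclusion
  `∃ v, IsKNSSBlowupLimit v` is not linked to the blowing-up solution and is discharged in tree by `e₀`)
  does NOT deliver the crux's conclusion: the record zoom (Lemma 6.1 compactness) must be re-run on the
  given solution with Fatou plane by plane — that, plus the per-datum local Clay theory, is the content.

[folklore]
-/

noncomputable section

namespace Summit.NavierStokesRegularity.NavierStokesRegularity.Theorems.PlanarEnergyZoomANegative

-- `<Problem> = <Summit>` doubles the namespace segment; the lakefile sets this option tree-wide.
set_option linter.dupNamespace false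


open Set Filter Topology MeasureTheory Function
open scoped InnerProductSpace RealInnerProductSpace ContDiff ENNReal
open Literature.Analysis.FluidPDE
open Summit.NavierStokesRegularity.NavierStokesRegularity.Theses.PlaneEnergyCeiling
  (PlanarEnergyZoomA PlanarEnergyLiouville BoundedPlanarEnergyRegularity)

/-! ## Pure logic: the crux is `PlanarEnergyLiouville → BoundedPlanarEnergyRegularity` -/

/-- **`PlanarEnergyZoomA ⟺ (PlanarEnergyLiouville → BoundedPlanarEnergyRegularity)`.** (→) is the
four lines inside the route's `closes`: under the planar hypothesis, if Clay (A) failed the zoom crux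
would hand a nonzero member of the Liouville class to the Liouville theorem; (←) the conclusion of the
zoom crux is closed and is literally `¬ PlanarEnergyLiouville`, so either Liouville fails — and its
counterexample IS the conclusion — or the criterion crux refutes the hypothesis `¬ ClayA`. [folklore] -/
theorem planarEnergyZoomA_iff_liouville_imp_regularity :
    PlanarEnergyZoomA ↔ (PlanarEnergyLiouville → BoundedPlanarEnergyRegularity) := by
  constructor
  · intro h5 h3 ν hν u₀ hu₀ hdiv hdec hpl
    by_contra hA
    obtain ⟨v, M', hm, hmeas, hsm, hpb, t, ht, x, hx⟩ := h5 ν hν u₀ hu₀ hdiv hdec hpl hA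
    exact hx (h3 v hm hmeas hsm ⟨M', hpb⟩ t ht x)
  · intro h ν hν u₀ hu₀ hdiv hdec hpl hA
    by_contra hW
    refine hA (h ?_ ν hν u₀ hu₀ hdiv hdec hpl)
    intro v hm hmeas hsm hM t ht x
    obtain ⟨M', hpb⟩ := hM
    by_contra hx
    exact hW ⟨v, M', hm, hmeas, hsm, hpb, t, ht, x, hx⟩

/-- **What a refutation of the crux must produce**: the Liouville theorem in the planar-energy class
AND the failure of the criterion crux (a Clay datum carrying the planar bound along all its classical
Leray–Hopf solutions for which Clay (A) fails). [folklore] -/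
theorem not_planarEnergyZoomA_iff :
    ¬ PlanarEnergyZoomA ↔ (PlanarEnergyLiouville ∧ ¬ BoundedPlanarEnergyRegularity) := by
  rw [planarEnergyZoomA_iff_liouville_imp_regularity, Classical.not_imp]

/-! ## Hypothesis mutation: `¬ ClayA` dropped, `PlanarHyp` dropped -/

/-- **Dropping `¬ ClayA` turns the crux into `¬ PlanarEnergyLiouville` exactly.** The variant below is
`PlanarEnergyZoomA` verbatim with the hypothesis `¬ (∃ u p, … Clay (A) …)` deleted; (→) instantiate at
`ν = 1` and the zero datum, where the planar hypothesis holds (`planar_bound_of_zero_datum`), (←) a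
Liouville counterexample is the conclusion whatever the hypotheses. [folklore] -/
theorem zoomA_without_notClayA_iff_not_liouville :
    (∀ (ν : ℝ), 0 < ν → ∀ (u₀ : EuclideanSpace ℝ (Fin 3) → EuclideanSpace ℝ (Fin 3)),
      ContDiff ℝ (⊤ : ℕ∞) u₀ → NSWave0.IsDivFree u₀ → HasRapidSpatialDecay u₀ →
      (∀ (T : ℝ), 0 < T → ∀ (u : ℝ → EuclideanSpace ℝ (Fin 3) → EuclideanSpace ℝ (Fin 3))
        (p : ℝ → EuclideanSpace ℝ (Fin 3) → ℝ), IsClassicalNSSolutionOn (Set.Ico 0 T) ν 0 u p →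
        IsLerayHopfOn T ν 0 (u 0) u → u 0 = u₀ → ∃ M : ℝ, ∀ t ∈ Set.Ico 0 T,
        ∀ (R : EuclideanSpace ℝ (Fin 3) ≃ₗᵢ[ℝ] EuclideanSpace ℝ (Fin 3)) (c : ℝ),
        ∫⁻ y : EuclideanSpace ℝ (Fin 2), ‖u t (R (WithLp.toLp 2 ![y 0, y 1, c]))‖ₑ ^ 2 ≤ ENNReal.ofReal M) →
      ∃ (v : ℝ → EuclideanSpace ℝ (Fin 3) → EuclideanSpace ℝ (Fin 3)) (M' : ℝ),
        IsBoundedAncientMildSolution 1 v ∧ (∀ t < 0, AEStronglyMeasurable (v t) volume) ∧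
        ContDiffOn ℝ (⊤ : ℕ∞) (uncurry v) (Set.Iio 0 ×ˢ Set.univ) ∧
        (∀ t < 0, ∀ (R : EuclideanSpace ℝ (Fin 3) ≃ₗᵢ[ℝ] EuclideanSpace ℝ (Fin 3)) (c : ℝ),
          ∫⁻ y : EuclideanSpace ℝ (Fin 2), ‖v t (R (WithLp.toLp 2 ![y 0, y 1, c]))‖ₑ ^ 2 ≤ ENNReal.ofReal M') ∧
        ∃ t < 0, ∃ x, v t x ≠ 0) ↔ ¬ PlanarEnergyLiouville := by
  constructor
  · intro h hL
    -- the zero datum is smooth, divergence free (trace of the zero derivative) and rapidly decaying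
    -- (all derivatives vanish); its planar hypothesis holds by `planar_bound_of_zero_datum`
    -- (the same two facts are landed as `EulerProximatePump.Negative.hasRapidSpatialDecay_zero` etc.;
    -- inlined here to keep this file's import closure inside the route's definition modules)
    have hdiv : NSWave0.IsDivFree (0 : EuclideanSpace ℝ (Fin 3) → EuclideanSpace ℝ (Fin 3)) :=
      fun x => by simp [NSWave0.divergence]
    have hdec : HasRapidSpatialDecay (0 : EuclideanSpace ℝ (Fin 3) → EuclideanSpace ℝ (Fin 3)) :=
      fun n K => ⟨0, fun x => by
        have : iteratedFDeriv ℝ n (0 : EuclideanSpace ℝ (Fin 3) → EuclideanSpace ℝ (Fin 3)) x = 0 := by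
          rw [Pi.zero_def, iteratedFDeriv_fun_zero]; rfl
        rw [this, norm_zero, mul_zero]⟩
    obtain ⟨v, M', hm, hmeas, hsm, hpb, t, ht, x, hx⟩ :=
      h 1 one_pos 0 contDiff_const hdiv hdec
        (BoundedPlanarEnergyRegularityNegative.planar_bound_of_zero_datum zero_le_one)
    exact hx (hL v hm hmeas hsm ⟨M', hpb⟩ t ht x)
  · intro hL _ _ _ _ _ _ _
    by_contra hW
    apply hL
    intro v hm hmeas hsm hM t ht x
    obtain ⟨M', hpb⟩ := hM
    by_contra hx
    exact hW ⟨v, M', hm, hmeas, hsm, hpb, t, ht, x, hx⟩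

/-- **LOAD-BEARING modulo Liouville**: under the partner crux `PlanarEnergyLiouville`, the crux with
`¬ ClayA` dropped is FALSE — any proof of `PlanarEnergyZoomA` must use the failure of Clay (A) (it is
what starts the blow-up and the zoom), unless it disproves Liouville. [folklore] -/
theorem zoomA_false_without_notClayA_of_liouville (hL : PlanarEnergyLiouville) :
    ¬ (∀ (ν : ℝ), 0 < ν → ∀ (u₀ : EuclideanSpace ℝ (Fin 3) → EuclideanSpace ℝ (Fin 3)),
      ContDiff ℝ (⊤ : ℕ∞) u₀ → NSWave0.IsDivFree u₀ → HasRapidSpatialDecay u₀ →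
      (∀ (T : ℝ), 0 < T → ∀ (u : ℝ → EuclideanSpace ℝ (Fin 3) → EuclideanSpace ℝ (Fin 3))
        (p : ℝ → EuclideanSpace ℝ (Fin 3) → ℝ), IsClassicalNSSolutionOn (Set.Ico 0 T) ν 0 u p →
        IsLerayHopfOn T ν 0 (u 0) u → u 0 = u₀ → ∃ M : ℝ, ∀ t ∈ Set.Ico 0 T,
        ∀ (R : EuclideanSpace ℝ (Fin 3) ≃ₗᵢ[ℝ] EuclideanSpace ℝ (Fin 3)) (c : ℝ),
        ∫⁻ y : EuclideanSpace ℝ (Fin 2), ‖u t (R (WithLp.toLp 2 ![y 0, y 1, c]))‖ₑ ^ 2 ≤ ENNReal.ofReal M) →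
      ∃ (v : ℝ → EuclideanSpace ℝ (Fin 3) → EuclideanSpace ℝ (Fin 3)) (M' : ℝ),
        IsBoundedAncientMildSolution 1 v ∧ (∀ t < 0, AEStronglyMeasurable (v t) volume) ∧
        ContDiffOn ℝ (⊤ : ℕ∞) (uncurry v) (Set.Iio 0 ×ˢ Set.univ) ∧
        (∀ t < 0, ∀ (R : EuclideanSpace ℝ (Fin 3) ≃ₗᵢ[ℝ] EuclideanSpace ℝ (Fin 3)) (c : ℝ),
          ∫⁻ y : EuclideanSpace ℝ (Fin 2), ‖v t (R (WithLp.toLp 2 ![y 0, y 1, c]))‖ₑ ^ 2 ≤ ENNReal.ofReal M') ∧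
        ∃ t < 0, ∃ x, v t x ≠ 0) :=
  fun h => (zoomA_without_notClayA_iff_not_liouville.1 h) hL

/-- **Dropping the planar hypothesis turns the crux into `PlanarEnergyLiouville → NavierStokesRegularity`
exactly** ("Liouville in the planar-energy class alone settles Clay (A)"): the variant below is
`PlanarEnergyZoomA` verbatim with the planar hypothesis deleted. The planar hypothesis is what makes the
crux weaker than this — the zoom limit inherits bounded planar energies only from a solution that has
them. [folklore] -/
theorem zoomA_without_planarHyp_iff :
    (∀ (ν : ℝ), 0 < ν → ∀ (u₀ : EuclideanSpace ℝ (Fin 3) → EuclideanSpace ℝ (Fin 3)),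
      ContDiff ℝ (⊤ : ℕ∞) u₀ → NSWave0.IsDivFree u₀ → HasRapidSpatialDecay u₀ →
      ¬ (∃ (u : ℝ → EuclideanSpace ℝ (Fin 3) → EuclideanSpace ℝ (Fin 3))
          (p : ℝ → EuclideanSpace ℝ (Fin 3) → ℝ), IsSmoothOnHalfSpace u ∧ IsSmoothOnHalfSpace p ∧
          IsNavierStokesSolution ν 0 u₀ u p ∧ HasBoundedEnergy u) →
      ∃ (v : ℝ → EuclideanSpace ℝ (Fin 3) → EuclideanSpace ℝ (Fin 3)) (M' : ℝ),
        IsBoundedAncientMildSolution 1 v ∧ (∀ t < 0, AEStronglyMeasurable (v t) volume) ∧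
        ContDiffOn ℝ (⊤ : ℕ∞) (uncurry v) (Set.Iio 0 ×ˢ Set.univ) ∧
        (∀ t < 0, ∀ (R : EuclideanSpace ℝ (Fin 3) ≃ₗᵢ[ℝ] EuclideanSpace ℝ (Fin 3)) (c : ℝ),
          ∫⁻ y : EuclideanSpace ℝ (Fin 2), ‖v t (R (WithLp.toLp 2 ![y 0, y 1, c]))‖ₑ ^ 2 ≤ ENNReal.ofReal M') ∧
        ∃ t < 0, ∃ x, v t x ≠ 0) ↔ (PlanarEnergyLiouville → NavierStokesRegularity) := by
  constructor
  · intro h hL ν hν u₀ hu₀ hdiv hdec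
    by_contra hA
    obtain ⟨v, M', hm, hmeas, hsm, hpb, t, ht, x, hx⟩ := h ν hν u₀ hu₀ hdiv hdec hA
    exact hx (hL v hm hmeas hsm ⟨M', hpb⟩ t ht x)
  · intro h ν hν u₀ hu₀ hdiv hdec hA
    by_contra hW
    refine hA (h ?_ ν hν u₀ hu₀ hdiv hdec)
    intro v hm hmeas hsm hM t ht x
    obtain ⟨M', hpb⟩ := hM
    by_contra hx
    exact hW ⟨v, M', hm, hmeas, hsm, hpb, t, ht, x, hx⟩

/-! ## The planar clause of the conclusion is its only non-trivial content -/

/-- **The conclusion WITHOUT its planar clause is trivially inhabited** by the constant field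
`e₀ = EuclideanSpace.single 0 1`: a bounded ancient duality-mild solution (`ν = 1`; in-tree
`isBoundedAncientMildSolution_fun_const`, KNSS 2009 §1), measurable slices, jointly smooth, nonzero.
So the crux with the planar clause deleted from its conclusion holds whatever the hypotheses.
[cite: KochNadirashviliSereginSverak2009, §6 remark after Prop. 6.1 ("Consider constants, for example.")] -/
theorem zoomA_conclusion_without_planar_bound :
    ∃ (v : ℝ → EuclideanSpace ℝ (Fin 3) → EuclideanSpace ℝ (Fin 3)),
      IsBoundedAncientMildSolution 1 v ∧ (∀ t < 0, AEStronglyMeasurable (v t) volume) ∧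
      ContDiffOn ℝ (⊤ : ℕ∞) (uncurry v) (Set.Iio 0 ×ˢ Set.univ) ∧ ∃ t < 0, ∃ x, v t x ≠ 0 := by
  refine ⟨fun _ _ => EuclideanSpace.single 0 1,
    isBoundedAncientMildSolution_fun_const 1 (EuclideanSpace.single 0 1),
    fun _ _ => aestronglyMeasurable_const, contDiffOn_const, -1, by norm_num, 0, ?_⟩
  intro h
  have := congrArg (fun w : EuclideanSpace ℝ (Fin 3) => w 0) h
  simp at this

/-- **A nonzero constant has planar energy `⊤` through every plane** (a nonzero constant integrated
over `EuclideanSpace ℝ (Fin 2)`): constants — and with them the parasitic drifts — violate the planar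
clause, which is exactly the filter that removes the trivial members of the duality-form bounded
ancient class from the crux's conclusion. [folklore] -/
theorem lintegral_plane_const_eq_top {b : EuclideanSpace ℝ (Fin 3)} (hb : b ≠ 0)
    (R : EuclideanSpace ℝ (Fin 3) ≃ₗᵢ[ℝ] EuclideanSpace ℝ (Fin 3)) (c : ℝ) :
    ∫⁻ y : EuclideanSpace ℝ (Fin 2),
      ‖(fun _ : EuclideanSpace ℝ (Fin 3) => b) (R (WithLp.toLp 2 ![y 0, y 1, c]))‖ₑ ^ 2 = ⊤ := by
  have hne : ‖b‖ₑ ^ 2 ≠ 0 := by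
    apply pow_ne_zero
    rwa [enorm_ne_zero]
  simp only [lintegral_const, measure_univ_of_isAddLeftInvariant]
  exact ENNReal.mul_top hne

/-- **The in-tree KNSS blow-up-limit class does not carry the planar bound**: the constant `e₀` is an
`IsKNSSBlowupLimit` (in-tree `isKNSSBlowupLimit_const`, the witness that discharges the vendored
Prop. 6.1 `KNSS2009_blowup_generates_ancient_holds`) whose planar energies are unbounded (`⊤`). Hence
`∃ v, IsKNSSBlowupLimit v` does not yield the crux's conclusion; the zoom has to be re-run on the given
solution with Fatou plane by plane. [folklore] -/
theorem exists_isKNSSBlowupLimit_planar_unbounded :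
    ∃ v : ℝ → EuclideanSpace ℝ (Fin 3) → EuclideanSpace ℝ (Fin 3), IsKNSSBlowupLimit v ∧
      ¬ ∃ M' : ℝ, ∀ t < 0, ∀ (R : EuclideanSpace ℝ (Fin 3) ≃ₗᵢ[ℝ] EuclideanSpace ℝ (Fin 3)) (c : ℝ),
        ∫⁻ y : EuclideanSpace ℝ (Fin 2), ‖v t (R (WithLp.toLp 2 ![y 0, y 1, c]))‖ₑ ^ 2 ≤
          ENNReal.ofReal M' := by
  have hb : (EuclideanSpace.single 0 1 : EuclideanSpace ℝ (Fin 3)) ≠ 0 := by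
    intro h
    have := congrArg (fun w : EuclideanSpace ℝ (Fin 3) => w 0) h
    simp at this
  refine ⟨fun _ _ => EuclideanSpace.single 0 1, isKNSSBlowupLimit_const (by simp), ?_⟩
  rintro ⟨M', hM'⟩
  have hle := hM' (-1) (by norm_num) (LinearIsometryEquiv.refl ℝ (EuclideanSpace ℝ (Fin 3))) 0
  rw [lintegral_plane_const_eq_top hb (LinearIsometryEquiv.refl ℝ (EuclideanSpace ℝ (Fin 3))) 0] at hle
  exact ENNReal.ofReal_ne_top (top_le_iff.1 hle)

end Summit.NavierStokesRegularity.NavierStokesRegularity.Theorems.PlanarEnergyZoomANegative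

end
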